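import Mathlib
import HarnessLib

/-!
# Zhang (2022) §8 p. 48, "it follows by partial integration that (8.11)" — the abstract
# partial-summation lemma against a logarithmic counting function `A(x) = c log x + O(K)`

Topic `Literature/NumberTheory/LFunctions/Zhang2022` (Landau–Siegel audit tree; verdict-neutral).
Y. Zhang, *Discrete mean estimates and the Landau–Siegel zero*, arXiv:2211.02515v1 (2022)
[Zhang2022LandauSiegel] — **an unrefereed manuscript under adjudication** (D-0069 campaign, cell
`siegel-zhang`, discharge seat d16). On p. 48 (tex L2459–L2471) the manuscript passes from the
arithmetic sum `Σ_{n<P₂} |χ(n)|λ₀ⱼ(n)φ(n)⁻¹·(…)(…) + Σ_{P₂≤n<P₁}(…)` to the integrals (8.11) "by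
partial integration", using `Σ_{n<x}|χ(n)|φ(n)/n² = 𝔠 log x + O(log 𝓛)`. This file PROVES the
abstract step, for ANY real weights `a(k)` whose summatory function is `c log x + O(K)` and any
`C¹` profile `F` (the manuscript's profiles are the `𝔣𝔤`-products of (8.11)):

* `norm_sum_mul_sub_integral_le` — if `|Σ_{k≤t} a(k) − c log t| ≤ K` (`t ≥ 1`) and on `[u, v]`
  (`1 ≤ u ≤ v`) `F` has a continuous derivative `F′` with `‖F‖ ≤ M`, `‖F′(t)‖ ≤ M′/t`, then
  `‖Σ_{u<k≤v} a(k)F(k) − c∫_u^v F(t)dt/t‖ ≤ K(2M + M′ log(v/u))`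
  (Abel summation `sum_mul_eq_sub_sub_integral_mul` + integration by parts of `∫F′ log`);
* `norm_sum_Icc_mul_sub_integral_le` — the same from the origin (`a(0) = 0`, `u = 1`):
  `‖Σ_{k≤v} a(k)F(k) − c∫₁^v F dt/t‖ ≤ K(3M + M′ log v)`.

All constants explicit; no number theory. Consumers: the (8.11) deduction `Section8cStatements.Ded811`
(with `a(n) = |χ(n)|φ(n)/n²`, `c = (6/π²)∏_{q∣D} q/(q+1)`, `K = O(𝓛²)` from
`Sieve.CoprimeTotient.abs_sum_norm_mul_totient_div_sq_sub_le`), and the analogous steps of §9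
("similar to (8.12)") and §10.

WHAT THIS IS NOT: any claim about Theorems 1–2 of the manuscript or about Landau–Siegel zeros.

## References

* Y. Zhang, arXiv:2211.02515v1 (2022), §8 p. 48, (8.11) (tex L2466). [cite: Zhang2022LandauSiegel, §8 (8.11)]
-/

noncomputable section

open Finset MeasureTheory intervalIntegral Set

namespace Literature.NumberTheory.LFunctions.Zhang2022.AbelLog

/-- **Partial integration against a logarithmic counting function** (the abstract content of
"it follows by partial integration that (8.11)", Zhang §8 p. 48): if the summatory function
`A(t) = Σ_{k ≤ t} a(k)` satisfies `|A(t) − c log t| ≤ K` for `t ≥ 1`, and `F` is `C¹` on `[u, v]`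
(`1 ≤ u ≤ v`) with `‖F‖ ≤ M`, `‖F′(t)‖ ≤ M′/t` there, then
`‖Σ_{u < k ≤ v} a(k)F(k) − c∫_u^v F(t)dt/t‖ ≤ K(2M + M′ log(v/u))`.
[cite: Zhang2022LandauSiegel, §8 (8.11) p.48, tex L2466] -/
theorem norm_sum_mul_sub_integral_le {a : ℕ → ℝ} {c K : ℝ}
    (hA : ∀ t : ℝ, 1 ≤ t → |(∑ k ∈ Icc 0 ⌊t⌋₊, a k) - c * Real.log t| ≤ K)
    {F F' : ℝ → ℂ} {u v : ℝ} (hu : 1 ≤ u) (huv : u ≤ v)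
    (hF : ∀ t ∈ Set.Icc u v, HasDerivAt F (F' t) t) (hF' : ContinuousOn F' (Set.Icc u v))
    {M M' : ℝ} (hM : ∀ t ∈ Set.Icc u v, ‖F t‖ ≤ M) (hM' : ∀ t ∈ Set.Icc u v, ‖F' t‖ ≤ M' / t) :
    ‖(∑ k ∈ Ioc ⌊u⌋₊ ⌊v⌋₊, (a k : ℂ) * F k) - c * ∫ t in u..v, F t / t‖ ≤
      K * (2 * M + M' * Real.log (v / u)) := by
  -- notation
  set S : ℝ → ℂ := fun t => ∑ k ∈ Icc 0 ⌊t⌋₊, (a k : ℂ) with hS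
  set E : ℝ → ℂ := fun t => S t - c * (Real.log t : ℂ) with hE
  have hu0 : 0 ≤ u := le_trans zero_le_one hu
  have hv1 : 1 ≤ v := le_trans hu huv
  have hSreal : ∀ t, S t = ((∑ k ∈ Icc 0 ⌊t⌋₊, a k : ℝ) : ℂ) := fun t => by
    rw [hS]; push_cast; rfl
  have hEK : ∀ t, 1 ≤ t → ‖E t‖ ≤ K := by
    intro t ht
    have : E t = (((∑ k ∈ Icc 0 ⌊t⌋₊, a k) - c * Real.log t : ℝ) : ℂ) := by
      rw [hE]; simp only [hSreal]; push_cast; ring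
    rw [this, Complex.norm_real, Real.norm_eq_abs]
    exact hA t ht
  have hK0 : 0 ≤ K := le_trans (abs_nonneg _) (hA 1 le_rfl)
  have hM0 : 0 ≤ M := le_trans (norm_nonneg _) (hM u ⟨le_rfl, huv⟩)
  have hM'0 : 0 ≤ M' := by
    have h := hM' u ⟨le_rfl, huv⟩
    have : 0 ≤ M' / u := le_trans (norm_nonneg _) h
    exact (div_nonneg_iff.mp this).elim (fun h => h.1) fun h => by
      exfalso; linarith [h.2]
  -- Abel summation
  have hdiff : ∀ t ∈ Set.Icc u v, DifferentiableAt ℝ F t := fun t ht => (hF t ht).differentiableAt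
  have hderiv : ∀ t ∈ Set.Icc u v, deriv F t = F' t := fun t ht => (hF t ht).deriv
  have hF'int : IntegrableOn F' (Set.Icc u v) := hF'.integrableOn_compact isCompact_Icc
  have hdint : IntegrableOn (deriv F) (Set.Icc u v) :=
    hF'int.congr_fun (fun t ht => (hderiv t ht).symm) measurableSet_Icc
  have habel := sum_mul_eq_sub_sub_integral_mul (fun k => (a k : ℂ)) hu0 huv hdiff hdint
  -- rewrite the Abel identity with `F'` and `S`
  have hint_eq : ∫ t in Set.Ioc u v, deriv F t * ∑ k ∈ Icc 0 ⌊t⌋₊, (a k : ℂ) =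
      ∫ t in u..v, F' t * S t := by
    rw [intervalIntegral.integral_of_le huv]
    refine setIntegral_congr_fun measurableSet_Ioc fun t ht => ?_
    rw [hderiv t ⟨ht.1.le, ht.2⟩]
  have hsum : (∑ k ∈ Ioc ⌊u⌋₊ ⌊v⌋₊, (a k : ℂ) * F k) =
      F v * S v - F u * S u - ∫ t in u..v, F' t * S t := by
    rw [← hint_eq, ← habel]
    exact Finset.sum_congr rfl fun k _ => mul_comm _ _
  -- integration by parts for `∫ F' log`
  have hlog : ∀ t ∈ Set.uIcc u v, HasDerivAt (fun x : ℝ => (Real.log x : ℂ)) ((t⁻¹ : ℝ) : ℂ) t := by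
    intro t ht
    rw [Set.uIcc_of_le huv] at ht
    have ht0 : t ≠ 0 := by linarith [ht.1]
    exact (Real.hasDerivAt_log ht0).ofReal_comp
  have hFu : ∀ t ∈ Set.uIcc u v, HasDerivAt F (F' t) t := by
    intro t ht; rw [Set.uIcc_of_le huv] at ht; exact hF t ht
  have hF'ii : IntervalIntegrable F' volume u v := ContinuousOn.intervalIntegrable_of_Icc huv hF'
  have hinv_cont : ContinuousOn (fun t : ℝ => ((t⁻¹ : ℝ) : ℂ)) (Set.Icc u v) := by
    apply Continuous.comp_continuousOn Complex.continuous_ofReal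
    exact continuousOn_inv₀.mono fun t ht => by
      simp only [Set.mem_compl_iff, Set.mem_singleton_iff]; linarith [ht.1]
  have hinv_ii : IntervalIntegrable (fun t : ℝ => ((t⁻¹ : ℝ) : ℂ)) volume u v :=
    ContinuousOn.intervalIntegrable_of_Icc huv hinv_cont
  have hibp := intervalIntegral.integral_deriv_mul_eq_sub hFu hlog hF'ii hinv_ii
  -- `∫ (F' log + F/t) = F v log v - F u log u`
  have hFcont : ContinuousOn F (Set.Icc u v) :=
    fun t ht => (hF t ht).continuousAt.continuousWithinAt
  have hI1 : IntervalIntegrable (fun t => F' t * (Real.log t : ℂ)) volume u v := by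
    apply ContinuousOn.intervalIntegrable_of_Icc huv
    apply hF'.mul
    apply Continuous.comp_continuousOn Complex.continuous_ofReal
    exact Real.continuousOn_log.mono fun t ht => by
      simp only [Set.mem_compl_iff, Set.mem_singleton_iff]; linarith [ht.1]
  have hI2 : IntervalIntegrable (fun t => F t * ((t⁻¹ : ℝ) : ℂ)) volume u v :=
    ContinuousOn.intervalIntegrable_of_Icc huv (hFcont.mul hinv_cont)
  have hsplit : (∫ t in u..v, F' t * (Real.log t : ℂ) + F t * ((t⁻¹ : ℝ) : ℂ)) =
      (∫ t in u..v, F' t * (Real.log t : ℂ)) + ∫ t in u..v, F t * ((t⁻¹ : ℝ) : ℂ) :=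
    intervalIntegral.integral_add hI1 hI2
  have hFt : (∫ t in u..v, F t * ((t⁻¹ : ℝ) : ℂ)) = ∫ t in u..v, F t / t := by
    refine intervalIntegral.integral_congr fun t _ => ?_
    simp only [Complex.ofReal_inv, div_eq_mul_inv]
  have hlogint : (∫ t in u..v, F' t * (Real.log t : ℂ)) =
      F v * (Real.log v : ℂ) - F u * (Real.log u : ℂ) - ∫ t in u..v, F t / t := by
    rw [← hFt]
    have := hibp
    rw [hsplit] at this
    linear_combination this
  -- `∫ F' S = c ∫ F' log + ∫ F' E`
  have hSint : IntervalIntegrable (fun t => F' t * S t) volume u v := by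
    rw [intervalIntegrable_iff_integrableOn_Icc_of_le huv]
    exact integrableOn_mul_sum_Icc (fun k => (a k : ℂ)) hu0 hF'int
  have hEint : IntervalIntegrable (fun t => F' t * E t) volume u v := by
    have : (fun t => F' t * E t) = fun t => F' t * S t - c * (F' t * (Real.log t : ℂ)) := by
      funext t; rw [hE]; ring
    rw [this]
    exact hSint.sub (hI1.const_mul _)
  have hSE : (∫ t in u..v, F' t * S t) = c * (∫ t in u..v, F' t * (Real.log t : ℂ)) +
      ∫ t in u..v, F' t * E t := by
    have : (fun t => F' t * S t) = fun t => c * (F' t * (Real.log t : ℂ)) + F' t * E t := by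
      funext t; rw [hE]; ring
    rw [this, intervalIntegral.integral_add (hI1.const_mul _) hEint,
      intervalIntegral.integral_const_mul]
  -- the main identity
  have hmain : (∑ k ∈ Ioc ⌊u⌋₊ ⌊v⌋₊, (a k : ℂ) * F k) - c * ∫ t in u..v, F t / t =
      F v * E v - F u * E u - ∫ t in u..v, F' t * E t := by
    rw [hsum, hSE, hlogint]
    have hSv : S v = c * (Real.log v : ℂ) + E v := by rw [hE]; ring
    have hSu : S u = c * (Real.log u : ℂ) + E u := by rw [hE]; ring
    rw [hSv, hSu]
    ring
  rw [hmain]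
  -- bounds
  have h1 : ‖F v * E v‖ ≤ M * K := by
    rw [norm_mul]; exact mul_le_mul (hM v ⟨huv, le_rfl⟩) (hEK v hv1) (norm_nonneg _) hM0
  have h2 : ‖F u * E u‖ ≤ M * K := by
    rw [norm_mul]; exact mul_le_mul (hM u ⟨le_rfl, huv⟩) (hEK u hu) (norm_nonneg _) hM0
  have h3 : ‖∫ t in u..v, F' t * E t‖ ≤ ∫ t in u..v, K * M' * t⁻¹ := by
    apply intervalIntegral.norm_integral_le_of_norm_le huv
    · filter_upwards with t ht
      have ht' : t ∈ Set.Icc u v := ⟨ht.1.le, ht.2⟩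
      have ht1 : 1 ≤ t := le_trans hu ht.1.le
      have ht0 : 0 < t := by linarith
      rw [norm_mul]
      calc ‖F' t‖ * ‖E t‖ ≤ (M' / t) * K := mul_le_mul (hM' t ht') (hEK t ht1) (norm_nonneg _)
            (div_nonneg hM'0 ht0.le)
        _ = K * M' * t⁻¹ := by ring
    · apply ContinuousOn.intervalIntegrable_of_Icc huv
      apply ContinuousOn.mul continuousOn_const
      exact continuousOn_inv₀.mono fun t ht => by
        simp only [Set.mem_compl_iff, Set.mem_singleton_iff]; linarith [ht.1]
  have h4 : (∫ t in u..v, K * M' * t⁻¹) = K * M' * Real.log (v / u) := by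
    rw [intervalIntegral.integral_const_mul, integral_inv_of_pos (by linarith) (by linarith)]
  calc ‖F v * E v - F u * E u - ∫ t in u..v, F' t * E t‖
      ≤ ‖F v * E v - F u * E u‖ + ‖∫ t in u..v, F' t * E t‖ := norm_sub_le _ _
    _ ≤ ‖F v * E v‖ + ‖F u * E u‖ + ‖∫ t in u..v, F' t * E t‖ := by
        gcongr; exact norm_sub_le _ _
    _ ≤ M * K + M * K + K * M' * Real.log (v / u) := by
        rw [← h4]; exact add_le_add (add_le_add h1 h2) h3
    _ = K * (2 * M + M' * Real.log (v / u)) := by ring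


/-- The same from the origin: if moreover `a(0) = 0`, then for `v ≥ 1`
`‖Σ_{0 ≤ k ≤ v} a(k)F(k) − c∫₁^v F(t)dt/t‖ ≤ K(3M + M′ log v)` (`F` is `C¹` on `[1, v]`; the term
`k = 1` costs `|a(1)|·‖F(1)‖ ≤ KM`). [cite: Zhang2022LandauSiegel, §8 (8.11) p.48, tex L2466] -/
theorem norm_sum_Icc_mul_sub_integral_le {a : ℕ → ℝ} {c K : ℝ} (ha0 : a 0 = 0)
    (hA : ∀ t : ℝ, 1 ≤ t → |(∑ k ∈ Icc 0 ⌊t⌋₊, a k) - c * Real.log t| ≤ K)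
    {F F' : ℝ → ℂ} {v : ℝ} (hv : 1 ≤ v)
    (hF : ∀ t ∈ Set.Icc 1 v, HasDerivAt F (F' t) t) (hF' : ContinuousOn F' (Set.Icc 1 v))
    {M M' : ℝ} (hM : ∀ t ∈ Set.Icc 1 v, ‖F t‖ ≤ M) (hM' : ∀ t ∈ Set.Icc 1 v, ‖F' t‖ ≤ M' / t) :
    ‖(∑ k ∈ Icc 0 ⌊v⌋₊, (a k : ℂ) * F k) - c * ∫ t in (1:ℝ)..v, F t / t‖ ≤
      K * (3 * M + M' * Real.log v) := by
  have hcore := norm_sum_mul_sub_integral_le hA le_rfl hv hF hF' hM hM'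
  rw [Nat.floor_one, div_one] at hcore
  have hK0 : 0 ≤ K := le_trans (abs_nonneg _) (hA 1 le_rfl)
  have hM0 : 0 ≤ M := le_trans (norm_nonneg _) (hM 1 ⟨le_rfl, hv⟩)
  have ha1 : |a 1| ≤ K := by
    have h := hA 1 le_rfl
    rw [Nat.floor_one, Real.log_one, mul_zero, sub_zero] at h
    rw [show Finset.Icc 0 1 = {0, 1} by rfl, Finset.sum_pair (by norm_num), ha0, zero_add] at h
    exact h
  have hv1 : 1 ≤ ⌊v⌋₊ := Nat.one_le_floor_iff _ |>.mpr hv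
  have hsplit : (∑ k ∈ Icc 0 ⌊v⌋₊, (a k : ℂ) * F k) =
      (a 1 : ℂ) * F 1 + ∑ k ∈ Ioc 1 ⌊v⌋₊, (a k : ℂ) * F k := by
    rw [Finset.Icc_eq_cons_Ioc (Nat.zero_le _), Finset.sum_cons, ha0]
    rw [← Finset.Icc_add_one_left_eq_Ioc, zero_add, Finset.Icc_eq_cons_Ioc hv1, Finset.sum_cons]
    push_cast; ring
  rw [hsplit]
  have h1 : ‖(a 1 : ℂ) * F 1‖ ≤ K * M := by
    rw [norm_mul, Complex.norm_real, Real.norm_eq_abs]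
    exact mul_le_mul ha1 (hM 1 ⟨le_rfl, hv⟩) (norm_nonneg _) hK0
  calc ‖(a 1 : ℂ) * F 1 + ∑ k ∈ Ioc 1 ⌊v⌋₊, (a k : ℂ) * F k - c * ∫ t in (1:ℝ)..v, F t / t‖
      = ‖(a 1 : ℂ) * F 1 + (∑ k ∈ Ioc 1 ⌊v⌋₊, (a k : ℂ) * F k - c * ∫ t in (1:ℝ)..v, F t / t)‖ := by
        ring_nf
    _ ≤ ‖(a 1 : ℂ) * F 1‖ + ‖∑ k ∈ Ioc 1 ⌊v⌋₊, (a k : ℂ) * F k - c * ∫ t in (1:ℝ)..v, F t / t‖ :=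
        norm_add_le _ _
    _ ≤ K * M + K * (2 * M + M' * Real.log v) := add_le_add h1 hcore
    _ = K * (3 * M + M' * Real.log v) := by ring

/-- **Derivative-free statement form**: as `norm_sum_mul_sub_integral_le`, with `F` merely
differentiable at every point of `[u, v]` and the bound `‖deriv F(t)‖ ≤ M′/t` (no continuity of the
derivative is needed: `deriv F` is measurable and bounded on `[u, v]`, hence integrable).
[cite: Zhang2022LandauSiegel, §8 (8.11) p.48, tex L2466] -/
theorem norm_sum_mul_sub_integral_le_of_deriv {a : ℕ → ℝ} {c K : ℝ}
    (hA : ∀ t : ℝ, 1 ≤ t → |(∑ k ∈ Icc 0 ⌊t⌋₊, a k) - c * Real.log t| ≤ K)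
    {F : ℝ → ℂ} {u v : ℝ} (hu : 1 ≤ u) (huv : u ≤ v)
    (hF : ∀ t ∈ Set.Icc u v, DifferentiableAt ℝ F t)
    {M M' : ℝ} (hM : ∀ t ∈ Set.Icc u v, ‖F t‖ ≤ M)
    (hM' : ∀ t ∈ Set.Icc u v, ‖deriv F t‖ ≤ M' / t) :
    ‖(∑ k ∈ Ioc ⌊u⌋₊ ⌊v⌋₊, (a k : ℂ) * F k) - c * ∫ t in u..v, F t / t‖ ≤
      K * (2 * M + M' * Real.log (v / u)) := by
  -- notation
  set F' : ℝ → ℂ := deriv F with hF'def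
  set S : ℝ → ℂ := fun t => ∑ k ∈ Icc 0 ⌊t⌋₊, (a k : ℂ) with hS
  set E : ℝ → ℂ := fun t => S t - c * (Real.log t : ℂ) with hE
  have hu0 : 0 ≤ u := le_trans zero_le_one hu
  have hv1 : 1 ≤ v := le_trans hu huv
  have hSreal : ∀ t, S t = ((∑ k ∈ Icc 0 ⌊t⌋₊, a k : ℝ) : ℂ) := fun t => by
    rw [hS]; push_cast; rfl
  have hEK : ∀ t, 1 ≤ t → ‖E t‖ ≤ K := by
    intro t ht
    have : E t = (((∑ k ∈ Icc 0 ⌊t⌋₊, a k) - c * Real.log t : ℝ) : ℂ) := by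
      rw [hE]; simp only [hSreal]; push_cast; ring
    rw [this, Complex.norm_real, Real.norm_eq_abs]
    exact hA t ht
  have hK0 : 0 ≤ K := le_trans (abs_nonneg _) (hA 1 le_rfl)
  have hM0 : 0 ≤ M := le_trans (norm_nonneg _) (hM u ⟨le_rfl, huv⟩)
  have hM'0 : 0 ≤ M' := by
    have h := hM' u ⟨le_rfl, huv⟩
    have : 0 ≤ M' / u := le_trans (norm_nonneg _) h
    exact (div_nonneg_iff.mp this).elim (fun h => h.1) fun h => by
      exfalso; linarith [h.2]
  -- the derivative is bounded and measurable, hence integrable on `[u, v]`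
  have hFd : ∀ t ∈ Set.Icc u v, HasDerivAt F (F' t) t := fun t ht => (hF t ht).hasDerivAt
  have hF'bdd : ∀ t ∈ Set.Icc u v, ‖F' t‖ ≤ M' := by
    intro t ht
    have ht1 : 1 ≤ t := le_trans hu ht.1
    calc ‖F' t‖ ≤ M' / t := hM' t ht
      _ ≤ M' / 1 := by gcongr
      _ = M' := div_one _
  have hF'int : IntegrableOn F' (Set.Icc u v) := by
    refine Measure.integrableOn_of_bounded (M := M') (by rw [Real.volume_Icc]; exact ENNReal.ofReal_ne_top)
      (measurable_deriv F).aestronglyMeasurable ?_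
    rw [ae_restrict_iff' measurableSet_Icc]
    exact Filter.Eventually.of_forall hF'bdd
  have habel := sum_mul_eq_sub_sub_integral_mul (fun k => (a k : ℂ)) hu0 huv hF hF'int
  have hsum : (∑ k ∈ Ioc ⌊u⌋₊ ⌊v⌋₊, (a k : ℂ) * F k) =
      F v * S v - F u * S u - ∫ t in u..v, F' t * S t := by
    rw [intervalIntegral.integral_of_le huv, ← habel]
    exact Finset.sum_congr rfl fun k _ => mul_comm _ _
  -- integration by parts for `∫ F' log`
  have hlog : ∀ t ∈ Set.uIcc u v, HasDerivAt (fun x : ℝ => (Real.log x : ℂ)) ((t⁻¹ : ℝ) : ℂ) t := by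
    intro t ht
    rw [Set.uIcc_of_le huv] at ht
    have ht0 : t ≠ 0 := by linarith [ht.1]
    exact (Real.hasDerivAt_log ht0).ofReal_comp
  have hFu : ∀ t ∈ Set.uIcc u v, HasDerivAt F (F' t) t := by
    intro t ht; rw [Set.uIcc_of_le huv] at ht; exact hFd t ht
  have hF'ii : IntervalIntegrable F' volume u v :=
    (intervalIntegrable_iff_integrableOn_Icc_of_le huv).mpr hF'int
  have hlogc : ContinuousOn (fun t : ℝ => (Real.log t : ℂ)) (Set.Icc u v) := by
    apply Continuous.comp_continuousOn Complex.continuous_ofReal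
    exact Real.continuousOn_log.mono fun t ht => by
      simp only [Set.mem_compl_iff, Set.mem_singleton_iff]; linarith [ht.1]
  have hinv_cont : ContinuousOn (fun t : ℝ => ((t⁻¹ : ℝ) : ℂ)) (Set.Icc u v) := by
    apply Continuous.comp_continuousOn Complex.continuous_ofReal
    exact continuousOn_inv₀.mono fun t ht => by
      simp only [Set.mem_compl_iff, Set.mem_singleton_iff]; linarith [ht.1]
  have hinv_ii : IntervalIntegrable (fun t : ℝ => ((t⁻¹ : ℝ) : ℂ)) volume u v :=
    ContinuousOn.intervalIntegrable_of_Icc huv hinv_cont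
  have hibp := intervalIntegral.integral_deriv_mul_eq_sub hFu hlog hF'ii hinv_ii
  have hFcont : ContinuousOn F (Set.Icc u v) :=
    fun t ht => (hFd t ht).continuousAt.continuousWithinAt
  have hI1 : IntervalIntegrable (fun t => F' t * (Real.log t : ℂ)) volume u v := by
    rw [intervalIntegrable_iff_integrableOn_Icc_of_le huv]
    exact hF'int.mul_continuousOn hlogc isCompact_Icc
  have hI2 : IntervalIntegrable (fun t => F t * ((t⁻¹ : ℝ) : ℂ)) volume u v :=
    ContinuousOn.intervalIntegrable_of_Icc huv (hFcont.mul hinv_cont)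
  have hsplit : (∫ t in u..v, F' t * (Real.log t : ℂ) + F t * ((t⁻¹ : ℝ) : ℂ)) =
      (∫ t in u..v, F' t * (Real.log t : ℂ)) + ∫ t in u..v, F t * ((t⁻¹ : ℝ) : ℂ) :=
    intervalIntegral.integral_add hI1 hI2
  have hFt : (∫ t in u..v, F t * ((t⁻¹ : ℝ) : ℂ)) = ∫ t in u..v, F t / t := by
    refine intervalIntegral.integral_congr fun t _ => ?_
    simp only [Complex.ofReal_inv, div_eq_mul_inv]
  have hlogint : (∫ t in u..v, F' t * (Real.log t : ℂ)) =
      F v * (Real.log v : ℂ) - F u * (Real.log u : ℂ) - ∫ t in u..v, F t / t := by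
    rw [← hFt]
    have := hibp
    rw [hsplit] at this
    linear_combination this
  -- `∫ F' S = c ∫ F' log + ∫ F' E`
  have hSint : IntervalIntegrable (fun t => F' t * S t) volume u v := by
    rw [intervalIntegrable_iff_integrableOn_Icc_of_le huv]
    exact integrableOn_mul_sum_Icc (fun k => (a k : ℂ)) hu0 hF'int
  have hEint : IntervalIntegrable (fun t => F' t * E t) volume u v := by
    have : (fun t => F' t * E t) = fun t => F' t * S t - c * (F' t * (Real.log t : ℂ)) := by
      funext t; rw [hE]; ring
    rw [this]
    exact hSint.sub (hI1.const_mul _)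
  have hSE : (∫ t in u..v, F' t * S t) = c * (∫ t in u..v, F' t * (Real.log t : ℂ)) +
      ∫ t in u..v, F' t * E t := by
    have : (fun t => F' t * S t) = fun t => c * (F' t * (Real.log t : ℂ)) + F' t * E t := by
      funext t; rw [hE]; ring
    rw [this, intervalIntegral.integral_add (hI1.const_mul _) hEint,
      intervalIntegral.integral_const_mul]
  have hmain : (∑ k ∈ Ioc ⌊u⌋₊ ⌊v⌋₊, (a k : ℂ) * F k) - c * ∫ t in u..v, F t / t =
      F v * E v - F u * E u - ∫ t in u..v, F' t * E t := by
    rw [hsum, hSE, hlogint]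
    have hSv : S v = c * (Real.log v : ℂ) + E v := by rw [hE]; ring
    have hSu : S u = c * (Real.log u : ℂ) + E u := by rw [hE]; ring
    rw [hSv, hSu]
    ring
  rw [hmain]
  have h1 : ‖F v * E v‖ ≤ M * K := by
    rw [norm_mul]; exact mul_le_mul (hM v ⟨huv, le_rfl⟩) (hEK v hv1) (norm_nonneg _) hM0
  have h2 : ‖F u * E u‖ ≤ M * K := by
    rw [norm_mul]; exact mul_le_mul (hM u ⟨le_rfl, huv⟩) (hEK u hu) (norm_nonneg _) hM0
  have h3 : ‖∫ t in u..v, F' t * E t‖ ≤ ∫ t in u..v, K * M' * t⁻¹ := by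
    apply intervalIntegral.norm_integral_le_of_norm_le huv
    · filter_upwards with t ht
      have ht' : t ∈ Set.Icc u v := ⟨ht.1.le, ht.2⟩
      have ht1 : 1 ≤ t := le_trans hu ht.1.le
      have ht0 : 0 < t := by linarith
      rw [norm_mul]
      calc ‖F' t‖ * ‖E t‖ ≤ (M' / t) * K := mul_le_mul (hM' t ht') (hEK t ht1) (norm_nonneg _)
            (div_nonneg hM'0 ht0.le)
        _ = K * M' * t⁻¹ := by ring
    · apply ContinuousOn.intervalIntegrable_of_Icc huv
      apply ContinuousOn.mul continuousOn_const
      exact continuousOn_inv₀.mono fun t ht => by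
        simp only [Set.mem_compl_iff, Set.mem_singleton_iff]; linarith [ht.1]
  have h4 : (∫ t in u..v, K * M' * t⁻¹) = K * M' * Real.log (v / u) := by
    rw [intervalIntegral.integral_const_mul, integral_inv_of_pos (by linarith) (by linarith)]
  calc ‖F v * E v - F u * E u - ∫ t in u..v, F' t * E t‖
      ≤ ‖F v * E v - F u * E u‖ + ‖∫ t in u..v, F' t * E t‖ := norm_sub_le _ _
    _ ≤ ‖F v * E v‖ + ‖F u * E u‖ + ‖∫ t in u..v, F' t * E t‖ := by
        gcongr; exact norm_sub_le _ _
    _ ≤ M * K + M * K + K * M' * Real.log (v / u) := by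
        rw [← h4]; exact add_le_add (add_le_add h1 h2) h3
    _ = K * (2 * M + M' * Real.log (v / u)) := by ring

/-- Derivative-free form from the origin (`a(0) = 0`, `u = 1`), as `norm_sum_Icc_mul_sub_integral_le`.
[cite: Zhang2022LandauSiegel, §8 (8.11) p.48, tex L2466] -/
theorem norm_sum_Icc_mul_sub_integral_le_of_deriv {a : ℕ → ℝ} {c K : ℝ} (ha0 : a 0 = 0)
    (hA : ∀ t : ℝ, 1 ≤ t → |(∑ k ∈ Icc 0 ⌊t⌋₊, a k) - c * Real.log t| ≤ K)
    {F : ℝ → ℂ} {v : ℝ} (hv : 1 ≤ v) (hF : ∀ t ∈ Set.Icc 1 v, DifferentiableAt ℝ F t)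
    {M M' : ℝ} (hM : ∀ t ∈ Set.Icc 1 v, ‖F t‖ ≤ M) (hM' : ∀ t ∈ Set.Icc 1 v, ‖deriv F t‖ ≤ M' / t) :
    ‖(∑ k ∈ Icc 0 ⌊v⌋₊, (a k : ℂ) * F k) - c * ∫ t in (1:ℝ)..v, F t / t‖ ≤
      K * (3 * M + M' * Real.log v) := by
  have hcore := norm_sum_mul_sub_integral_le_of_deriv hA le_rfl hv hF hM hM'
  rw [Nat.floor_one, div_one] at hcore
  have hK0 : 0 ≤ K := le_trans (abs_nonneg _) (hA 1 le_rfl)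
  have hM0 : 0 ≤ M := le_trans (norm_nonneg _) (hM 1 ⟨le_rfl, hv⟩)
  have ha1 : |a 1| ≤ K := by
    have h := hA 1 le_rfl
    rw [Nat.floor_one, Real.log_one, mul_zero, sub_zero] at h
    rw [show Finset.Icc 0 1 = {0, 1} by rfl, Finset.sum_pair (by norm_num), ha0, zero_add] at h
    exact h
  have hv1 : 1 ≤ ⌊v⌋₊ := Nat.one_le_floor_iff _ |>.mpr hv
  have hsplit : (∑ k ∈ Icc 0 ⌊v⌋₊, (a k : ℂ) * F k) =
      (a 1 : ℂ) * F 1 + ∑ k ∈ Ioc 1 ⌊v⌋₊, (a k : ℂ) * F k := by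
    rw [Finset.Icc_eq_cons_Ioc (Nat.zero_le _), Finset.sum_cons, ha0]
    rw [← Finset.Icc_add_one_left_eq_Ioc, zero_add, Finset.Icc_eq_cons_Ioc hv1, Finset.sum_cons]
    push_cast; ring
  rw [hsplit]
  have h1 : ‖(a 1 : ℂ) * F 1‖ ≤ K * M := by
    rw [norm_mul, Complex.norm_real, Real.norm_eq_abs]
    exact mul_le_mul ha1 (hM 1 ⟨le_rfl, hv⟩) (norm_nonneg _) hK0
  calc ‖(a 1 : ℂ) * F 1 + ∑ k ∈ Ioc 1 ⌊v⌋₊, (a k : ℂ) * F k - c * ∫ t in (1:ℝ)..v, F t / t‖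
      = ‖(a 1 : ℂ) * F 1 + (∑ k ∈ Ioc 1 ⌊v⌋₊, (a k : ℂ) * F k - c * ∫ t in (1:ℝ)..v, F t / t)‖ := by
        ring_nf
    _ ≤ ‖(a 1 : ℂ) * F 1‖ + ‖∑ k ∈ Ioc 1 ⌊v⌋₊, (a k : ℂ) * F k - c * ∫ t in (1:ℝ)..v, F t / t‖ :=
        norm_add_le _ _
    _ ≤ K * M + K * (2 * M + M' * Real.log v) := add_le_add h1 hcore
    _ = K * (3 * M + M' * Real.log v) := by ring

end Literature.NumberTheory.LFunctions.Zhang2022.AbelLog
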